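import Literature.Probability.Percolation.PortOwners
import Literature.Probability.Percolation.Ports
import HarnessLib

/-!
# Port runs: between two closed contacts the hub contacts of the link domain belong to one hub

Topic `Probability/Percolation`.  Support file (definitions and proofs, no named fact) for step (C)
of the proof of Schramm–Smirnov's Prop. 4.1 (Ann. Probab. 39 (2011), §4, "Bays and beaches":
the beach of an open bay is one hub), in the language of tile domains.  Along the traced boundary
loop of the link domain `U` (`CellBoundary.lean`, `Ports.lean`) each side has its in-cell in `U` and
its out-cell outside; the out-cell is a HUB cell, a CLOSED cell (examined closed bond or wet face),
a POCKET cell (a fresh inaccessible window bond) or an EXTERIOR cell (a bond leaving the window)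
(`out_classification`).  The main result `hubConn_of_open_stretch`: on a stretch of the loop with no
closed and no exterior contact, all hub contacts have hub-connected attached vertices — so a PORT
(a maximal such stretch) has one owner hub.  Consecutive hub contacts share a corner
(`hubConn_of_run`, `Ports.lean`); a maximal run of pocket contacts goes around ONE face of `U`
(`pocket_run`), from a hub corner to a hub corner, and the chord and pocket lemmas of
`PortOwners.lean` join these corners.

## References

* O. Schramm, S. Smirnov, *On the scaling limits of planar percolation*, Ann. Probab. 39 (2011)
  1768–1814, arXiv:1101.5820, §4, proof of Prop. 4.1 ("Bays and beaches"). [SchrammSmirnov2011]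
-/

noncomputable section

open Set Relation
open Literature.Probability.LatticeModels
open scoped Classical

namespace Literature.Probability.Percolation

namespace CellComplex

/-! ### Face sides of a traced loop: the cells around the far corner -/

section FaceSide

variable {U : Finset (Site 2)} {d₀ : Site 2 × Fin 4}

/-- **Parameters of a face side.**  The `i`-th side of the loop is a face side with parameters
`(a, j)` if its far corner is `2a + cornerOff j` and its direction is `j + 1`; then its in-cell is
the face cell `φ (faceAt a (j+2))`, its out-cell the bond cell `β a (j+3)`, and the two cells ahead
are `β a (j+2)` (left) and `σ a` (right). [folklore] -/
def FaceSide (U : Finset (Site 2)) (d₀ : Site 2 × Fin 4) (i : ℕ) (a : Site 2) (j : Fin 4) : Prop :=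
  vert U d₀ (i + 1) = σc a + cornerOff j ∧ dirAt U d₀ i = j + 1

variable {i : ℕ} {a : Site 2} {j : Fin 4}

/-- The in-cell of a face side. [folklore] -/
theorem FaceSide.inCell (h : FaceSide U d₀ i a j) : faceAt (vert U d₀ i) (dirAt U d₀ i) = φc (faceAt a (j + 2)) := by
  have := faceAt_add_unit_succ (vert U d₀ i) (dirAt U d₀ i)
  rw [← vert_succ, h.1, h.2, fin4_add_one_add_one, faceAt_corner_add_two] at this
  rw [h.2]; exact this.symm

/-- The out-cell of a face side. [folklore] -/
theorem FaceSide.outCell (h : FaceSide U d₀ i a j) : faceAt (vert U d₀ i) (dirAt U d₀ i + 3) = βc a (j + 3) := by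
  have := faceAt_add_unit_add_two (vert U d₀ i) (dirAt U d₀ i)
  rw [← vert_succ, h.1, h.2, fin4_add_one_add_two, faceAt_corner_add_three] at this
  rw [h.2]; exact this.symm

/-- The cell ahead-left of a face side. [folklore] -/
theorem FaceSide.aheadLeft (h : FaceSide U d₀ i a j) : faceAt (vert U d₀ (i + 1)) (j + 1) = βc a (j + 2) := by
  rw [h.1, faceAt_corner_add_one]

/-- The cell ahead-right of a face side. [folklore] -/
theorem FaceSide.aheadRight (h : FaceSide U d₀ i a j) : faceAt (vert U d₀ (i + 1)) j = σc a := by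
  rw [h.1, faceAt_corner_self]

/-- **The tracing rule at the far corner of a face side.** [folklore] -/
theorem FaceSide.bdOrbit_succ (h : FaceSide U d₀ i a j) :
    bdOrbit U d₀ (i + 1) =
      if σc a ∈ U then (vert U d₀ (i + 1), j)
      else if βc a (j + 2) ∈ U then (vert U d₀ (i + 1), j + 1) else (vert U d₀ (i + 1), j + 2) := by
  have hd : bdOrbit U d₀ i = (vert U d₀ i, dirAt U d₀ i) := rfl
  rw [CellComplex.bdOrbit_succ, hd]
  unfold bdSucc
  simp only [head]
  rw [← vert_succ, h.2, fin4_add_one_add_three, h.aheadRight, h.aheadLeft, fin4_add_one_add_one]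

/-- Case R: if the site cell ahead-right is in `U`, the next side keeps the out-cell. [folklore] -/
theorem FaceSide.succ_of_site_mem (h : FaceSide U d₀ i a j) (hσ : σc a ∈ U) :
    faceAt (vert U d₀ (i + 1)) (dirAt U d₀ (i + 1) + 3) = βc a (j + 3) := by
  have hd : dirAt U d₀ (i + 1) = j := by
    show (bdOrbit U d₀ (i + 1)).2 = j
    rw [h.bdOrbit_succ, if_pos hσ]
  rw [hd, h.1, faceAt_corner_add_three]

/-- Case S: straight on; the next in-cell is `β a (j+2)` and the next out-cell `σ a`. [folklore] -/
theorem FaceSide.succ_of_bond_mem (h : FaceSide U d₀ i a j) (hσ : σc a ∉ U) (hβ : βc a (j + 2) ∈ U) :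
    faceAt (vert U d₀ (i + 1)) (dirAt U d₀ (i + 1)) = βc a (j + 2) ∧
      faceAt (vert U d₀ (i + 1)) (dirAt U d₀ (i + 1) + 3) = σc a := by
  have hd : dirAt U d₀ (i + 1) = j + 1 := by
    show (bdOrbit U d₀ (i + 1)).2 = j + 1
    rw [h.bdOrbit_succ, if_neg hσ, if_pos hβ]
  rw [hd, fin4_add_one_add_three]
  exact ⟨h.aheadLeft, h.aheadRight⟩

/-- `cornerOff j + e_{j+2} = 2 e_{j+2} + cornerOff (j+1)`. [folklore] -/
theorem cornerOff_add_cornerUnit_add_two (j : Fin 4) :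
    cornerOff j + cornerUnit (j + 2) = cornerUnit (j + 2) + cornerUnit (j + 2) + cornerOff (j + 1) := by
  fin_cases j <;> decide

/-- Case L: turn left; the next side is a face side of the SAME face, with parameters
`(a + e_{j+2}, j + 1)`, and its out-cell is `β a (j+2)`. [folklore] -/
theorem FaceSide.succ_of_not_mem (h : FaceSide U d₀ i a j) (hσ : σc a ∉ U) (hβ : βc a (j + 2) ∉ U) :
    FaceSide U d₀ (i + 1) (a + cornerUnit (j + 2)) (j + 1) ∧
      faceAt (vert U d₀ (i + 1)) (dirAt U d₀ (i + 1) + 3) = βc a (j + 2) := by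
  have hd : dirAt U d₀ (i + 1) = j + 2 := by
    show (bdOrbit U d₀ (i + 1)).2 = j + 2
    rw [h.bdOrbit_succ, if_neg hσ, if_neg hβ]
  refine ⟨⟨?_, by rw [hd, fin4_add_one_add_one]⟩, ?_⟩
  · rw [vert_succ, hd, h.1, σc_add_cornerUnit, add_assoc, cornerOff_add_cornerUnit_add_two]; abel
  · rw [hd, fin4_add_two_add_three, h.aheadLeft]

/-- The face of the next side in case L is the same face. [folklore] -/
theorem faceAt_add_cornerUnit_add_two_succ (a : Site 2) (j : Fin 4) :
    faceAt (a + cornerUnit (j + 2)) (j + 1 + 2) = faceAt a (j + 2) := by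
  rw [fin4_add_one_add_two, show j + 3 = j + 2 + 1 from (fin4_add_two_add_one j).symm, faceAt_add_unit_succ]

/-- **A side whose in-cell is a face cell is a face side.** [folklore] -/
theorem exists_faceSide_of_inCell {f : Site 2} (hin : faceAt (vert U d₀ i) (dirAt U d₀ i) = φc f) :
    ∃ a j, FaceSide U d₀ i a j ∧ f = faceAt a (j + 2) := by
  obtain ⟨a, j', hw⟩ := exists_corner_eq (vert U d₀ (i + 1))
  have hin' : faceAt (vert U d₀ (i + 1)) (dirAt U d₀ i + 1) = φc f := by
    rw [vert_succ, faceAt_add_unit_succ, hin]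
  rw [hw] at hin'
  obtain ⟨t, ht⟩ := fin4_exists_add j' (dirAt U d₀ i + 1)
  rw [ht] at hin'
  rcases (show t = 0 ∨ t = 1 ∨ t = 2 ∨ t = 3 by fin_cases t <;> simp) with rfl | rfl | rfl | rfl
  · rw [add_zero, faceAt_corner_self] at hin'
    exact absurd hin' (σc_ne_φc a f)
  · rw [faceAt_corner_add_one] at hin'
    exact absurd hin' (βc_ne_φc a f (j' + 2))
  · rw [faceAt_corner_add_two] at hin'
    refine ⟨a, j', ⟨hw, ?_⟩, (φc_injective hin').symm⟩
    have : dirAt U d₀ i + 1 + 3 = j' + 2 + 3 := congrArg (· + 3) ht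
    rwa [fin4_add_one_add_three, fin4_add_two_add_three] at this
  · rw [faceAt_corner_add_three] at hin'
    exact absurd hin' (βc_ne_φc a f (j' + 3))

end FaceSide

/-! ### Out-cells of the loop of a tile domain: hub, closed, pocket, exterior -/

namespace TileData

variable (𝒯 : TileData)

/-- **Closed cells**: bond cells of examined closed edges and wet face cells. [folklore] -/
def IsClosedCell (c : Site 2) : Prop := (∃ e ∈ 𝒯.clE, e ∈ (zdGraph 2).edgeSet ∧ c = bcell e) ∨ ∃ f ∈ 𝒯.Dset, c = φc f

/-- **Fresh window bonds**: the bond cell of a lattice edge that is neither examined nor accessible,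
with both endpoints in the window. [folklore] -/
def IsPocketCell (c : Site 2) : Prop :=
  ∃ (y : Site 2) (m : Fin 4), c = βc y m ∧ dartEdge y m ∉ 𝒯.hubE ∧ dartEdge y m ∉ 𝒯.clE ∧ dartEdge y m ∉ 𝒯.acc ∧
    y ∈ 𝒯.Wv ∧ y + cornerUnit m ∈ 𝒯.Wv

/-- **Exterior cells**: bond cells of edges with an endpoint outside the window. [folklore] -/
def IsExteriorCell (c : Site 2) : Prop := ∃ (y : Site 2) (m : Fin 4), c = βc y m ∧ (y ∉ 𝒯.Wv ∨ y + cornerUnit m ∉ 𝒯.Wv)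

variable {𝒯}

/-- **Classification of the out-cells.**  If a cell of `U` and a cell outside `U` share a side
(a boundary dart `d`: left cell in, right cell out), the out-cell is a hub cell, a closed cell, a
pocket cell or an exterior cell; and if it is a pocket cell, the in-cell is a face cell.
[folklore] -/
theorem out_classification {d : Site 2 × Fin 4} (hd : IsBd 𝒯.U d) :
    𝒯.IsHubCell (faceAt d.1 (d.2 + 3)) ∨ 𝒯.IsClosedCell (faceAt d.1 (d.2 + 3)) ∨
      (𝒯.IsPocketCell (faceAt d.1 (d.2 + 3)) ∧ ∃ f, faceAt d.1 d.2 = φc f) ∨ 𝒯.IsExteriorCell (faceAt d.1 (d.2 + 3)) := by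
  obtain ⟨hin, hout⟩ := hd
  -- the corner structure at the tail of the dart: in-cell `faceAt v k`, out-cell `faceAt v (k+3)` are
  -- consecutive cells around `v = 2y + cornerOff j'`
  obtain ⟨v, k⟩ := d
  simp only at hin hout ⊢
  obtain ⟨y, j', rfl⟩ := exists_corner_eq v
  obtain ⟨t, rfl⟩ := fin4_exists_add j' k
  -- the four positions of the in-cell
  rcases (show t = 0 ∨ t = 1 ∨ t = 2 ∨ t = 3 by fin_cases t <;> simp) with rfl | rfl | rfl | rfl
  · -- in-cell `σ y` (t = 0), out-cell `faceAt _ (j'+3) = β y (j'+3)`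
    rw [add_zero] at hin hout ⊢
    rw [faceAt_corner_self] at hin
    rw [faceAt_corner_add_three] at hout ⊢
    -- `y` accessible non-hub; the edge `dartEdge y (j'+3)` at `y`
    obtain ⟨hyO, e, he, hye⟩ := (σc_mem_U_iff 𝒯).1 hin
    by_cases hW : y + cornerUnit (j' + 3) ∈ 𝒯.Wv
    · have hwin : ∀ u ∈ dartEdge y (j' + 3), u ∈ 𝒯.Wv := by
        intro u hu
        rcases mem_dartEdge_iff.1 hu with rfl | rfl
        · exact 𝒯.acc_window e he _ hye
        · exact hW
      rcases 𝒯.closure e he y hye hyO _ (dartEdge_mem_edgeSet _ _) (mem_dartEdge_iff.2 (Or.inl rfl)) hwin with h | h | h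
      · exact Or.inl (Or.inr ⟨y, j' + 3, h, rfl⟩)
      · exact Or.inr (Or.inl (Or.inl ⟨_, h, dartEdge_mem_edgeSet _ _, (bcell_dartEdge _ _).symm⟩))
      · exact absurd ((βc_mem_U_iff 𝒯).2 h) hout
    · exact Or.inr (Or.inr (Or.inr ⟨y, j' + 3, rfl, Or.inr hW⟩))
  · -- in-cell `β y (j'+2)` (t = 1), out-cell `faceAt _ (j'+1+3) = σ y`
    rw [faceAt_corner_add_one] at hin
    rw [fin4_add_one_add_three, faceAt_corner_self] at hout ⊢
    -- the accessible edge `dartEdge y (j'+2)` at `y`, `σ y ∉ U` ⇒ `y ∈ O`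
    have hacc : dartEdge y (j' + 2) ∈ 𝒯.acc := (βc_mem_U_iff 𝒯).1 hin
    have hyO : y ∈ 𝒯.O := by
      by_contra hyO
      exact hout ((σc_mem_U_iff 𝒯).2 ⟨hyO, _, hacc, mem_dartEdge_iff.2 (Or.inl rfl)⟩)
    exact Or.inl (Or.inl ⟨y, hyO, rfl⟩)
  · -- in-cell `φ (faceAt y (j'+2))` (t = 2), out-cell `faceAt _ (j'+2+3) = β y (j'+2)`
    have hin₀ := hin
    rw [faceAt_corner_add_two] at hin
    rw [fin4_add_two_add_three, faceAt_corner_add_one] at hout ⊢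
    set e := dartEdge y (j' + 2) with he
    by_cases hhub : e ∈ 𝒯.hubE
    · exact Or.inl (Or.inr ⟨y, j' + 2, hhub, rfl⟩)
    by_cases hcl : e ∈ 𝒯.clE
    · exact Or.inr (Or.inl (Or.inl ⟨e, hcl, dartEdge_mem_edgeSet _ _, (bcell_dartEdge _ _).symm⟩))
    have hacc : e ∉ 𝒯.acc := fun h => hout ((βc_mem_U_iff 𝒯).2 h)
    by_cases hW : y ∈ 𝒯.Wv ∧ y + cornerUnit (j' + 2) ∈ 𝒯.Wv
    · exact Or.inr (Or.inr (Or.inl ⟨⟨y, j' + 2, rfl, hhub, hcl, hacc, hW.1, hW.2⟩, _, faceAt_corner_add_two y j'⟩))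
    · refine Or.inr (Or.inr (Or.inr ⟨y, j' + 2, rfl, ?_⟩))
      by_cases h1 : y ∈ 𝒯.Wv
      · exact Or.inr fun h2 => hW ⟨h1, h2⟩
      · exact Or.inl h1
  · -- in-cell `β y (j'+3)` (t = 3), out-cell `faceAt _ (j'+3+3) = φ (faceAt y (j'+2))`
    rw [faceAt_corner_add_three] at hin
    rw [fin4_add_three_add_three, faceAt_corner_add_two] at hout ⊢
    have hacc : dartEdge y (j' + 3) ∈ 𝒯.acc := (βc_mem_U_iff 𝒯).1 hin
    by_cases hD : faceAt y (j' + 2) ∈ 𝒯.Dset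
    · exact Or.inr (Or.inl (Or.inr ⟨_, hD, rfl⟩))
    · exfalso
      refine hout ((φc_mem_U_iff 𝒯).2 ⟨hD, _, hacc, ?_⟩)
      exact isFaceOf_dartEdge_iff.2 (Or.inr (by rw [fin4_add_three_add_three]))

end TileData

/-! ### Face sides indexed by the face and the position of the side -/

section FSide

variable {U : Finset (Site 2)} {d₀ : Site 2 × Fin 4} {i : ℕ} {f : Site 2} {m : Fin 4}

/-- The `i`-th side of the loop runs along the `m`-th side of the face `f` (in-cell `φ f`, out-cell
the bond cell of `faceSide f m`, from the corner `f + cornerOff m` to the corner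
`f + cornerOff (m+1)`). [folklore] -/
def FSide (U : Finset (Site 2)) (d₀ : Site 2 × Fin 4) (i : ℕ) (f : Site 2) (m : Fin 4) : Prop :=
  FaceSide U d₀ i (f + cornerOff (m + 1)) (m + 3)

/-- The in-cell of an `f`-side is `φ f`. [folklore] -/
theorem FSide.inCell (h : FSide U d₀ i f m) : faceAt (vert U d₀ i) (dirAt U d₀ i) = φc f := by
  rw [FaceSide.inCell h, DiscreteDobrushin.fin4_three_two, faceAt_add_cornerOff]

/-- The out-cell of an `f`-side is the bond cell of `faceSide f m`. [folklore] -/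
theorem FSide.outCell (h : FSide U d₀ i f m) : faceAt (vert U d₀ i) (dirAt U d₀ i + 3) = βc (f + cornerOff m) m := by
  rw [FaceSide.outCell h, fin4_add_three_add_three, add_cornerOff_succ, βc_rev]


/-- The far corner site of an `f`-side. [folklore] -/
theorem FSide.vert_succ (h : FSide U d₀ i f m) : vert U d₀ (i + 1) = σc (f + cornerOff (m + 1)) + cornerOff (m + 3) := h.1

/-- `σ` and `cornerOff` bookkeeping: the near corner of an `f`-side. [folklore] -/
theorem σc_add_cornerOff_sub (b : Site 2) (m : Fin 4) :
    σc (b + cornerUnit m) + cornerOff (m + 3) - cornerUnit (m + 3 + 1) = σc b + cornerOff (m + 2) := by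
  rw [fin4_add_three_add_one, σc_add_cornerUnit]
  have : cornerOff (m + 3) - cornerUnit m = cornerOff (m + 2) - cornerUnit m - cornerUnit m := by
    fin_cases m <;> decide
  rw [add_sub_assoc, this]; abel

/-- The near corner of an `f`-side: `vert i = 2 (f + cornerOff m) + cornerOff (m + 2)`. [folklore] -/
theorem FSide.vert_eq (h : FSide U d₀ i f m) : vert U d₀ i = σc (f + cornerOff m) + cornerOff (m + 2) := by
  have hv := CellComplex.vert_succ (U := U) (d₀ := d₀) i
  rw [h.1, h.2] at hv
  have : vert U d₀ i = σc (f + cornerOff (m + 1)) + cornerOff (m + 3) - cornerUnit (m + 3 + 1) :=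
    eq_sub_of_add_eq hv.symm
  rw [this, add_cornerOff_succ, σc_add_cornerOff_sub]

/-- Case R does not occur for a pocket side: if the site cell ahead-right is in `U` the out-cell is
kept. [folklore] -/
theorem FSide.outCell_succ_of_site_mem (h : FSide U d₀ i f m) (hσ : σc (f + cornerOff (m + 1)) ∈ U) :
    faceAt (vert U d₀ (i + 1)) (dirAt U d₀ (i + 1) + 3) = βc (f + cornerOff m) m := by
  rw [FaceSide.succ_of_site_mem h hσ, fin4_add_three_add_three, add_cornerOff_succ, βc_rev]

/-- Case S: the next out-cell is the site cell of the far corner. [folklore] -/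
theorem FSide.outCell_succ_of_bond_mem (h : FSide U d₀ i f m) (hσ : σc (f + cornerOff (m + 1)) ∉ U)
    (hβ : βc (f + cornerOff (m + 1)) (m + 1) ∈ U) :
    faceAt (vert U d₀ (i + 1)) (dirAt U d₀ (i + 1) + 3) = σc (f + cornerOff (m + 1)) := by
  have hβ' : βc (f + cornerOff (m + 1)) (m + 3 + 2) ∈ U := by
    rwa [DiscreteDobrushin.fin4_three_two]
  exact (FaceSide.succ_of_bond_mem h hσ hβ').2

/-- Case L: the next side is the next side of the same face. [folklore] -/
theorem FSide.succ_of_not_mem (h : FSide U d₀ i f m) (hσ : σc (f + cornerOff (m + 1)) ∉ U)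
    (hβ : βc (f + cornerOff (m + 1)) (m + 1) ∉ U) :
    FSide U d₀ (i + 1) f (m + 1) ∧ faceAt (vert U d₀ (i + 1)) (dirAt U d₀ (i + 1) + 3) = βc (f + cornerOff (m + 1)) (m + 1) := by
  have hβ' : βc (f + cornerOff (m + 1)) (m + 3 + 2) ∉ U := by
    rwa [DiscreteDobrushin.fin4_three_two]
  obtain ⟨h1, h2⟩ := FaceSide.succ_of_not_mem h hσ hβ'
  refine ⟨?_, ?_⟩
  · -- parameters `(f + cornerOff (m+1) + e_{m+1}, m)` = `(f + cornerOff (m+1+1), m+1+3)`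
    unfold FSide
    rw [fin4_add_one_add_three, add_cornerOff_succ f (m + 1)]
    rwa [DiscreteDobrushin.fin4_three_two, fin4_add_three_add_one] at h1
  · rwa [DiscreteDobrushin.fin4_three_two] at h2

/-- An `f`-side from a face side. [folklore] -/
theorem fSide_of_faceSide {a : Site 2} {j : Fin 4} (h : FaceSide U d₀ i a j) : FSide U d₀ i (faceAt a (j + 2)) (j + 1) := by
  unfold FSide
  rwa [fin4_add_one_add_three, show j + 1 + 1 = j + 2 from fin4_add_one_add_one j, faceAt, sub_add_cancel]

end FSide

/-! ### Pocket runs -/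

namespace TileData

variable {𝒯 : TileData} {d₀ : Site 2 × Fin 4}

/-- A pocket out-cell is not a hub cell, and is a fresh inaccessible window bond. [folklore] -/
theorem not_isHubCell_of_isPocketCell {c : Site 2} (h : 𝒯.IsPocketCell c) : ¬ 𝒯.IsHubCell c := by
  obtain ⟨y, m, rfl, hhub, -, -, -, -⟩ := h
  intro hc
  exact hhub (𝒯.mem_hubE_of_isHubCell_βc hc)

/-- A pocket cell is not a site cell. [folklore] -/
theorem IsPocketCell.ne_σc {c : Site 2} (h : 𝒯.IsPocketCell c) (v : Site 2) : c ≠ σc v := by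
  obtain ⟨y, m, rfl, -⟩ := h
  exact (σc_ne_βc v y m).symm

/-- Reading off the edge of a pocket out-cell of an `f`-side: the side `faceSide f m` is a fresh,
inaccessible window edge. [folklore] -/
theorem pocket_edge {i : ℕ} {f : Site 2} {m : Fin 4} (h : FSide 𝒯.U d₀ i f m)
    (hp : 𝒯.IsPocketCell (faceAt (vert 𝒯.U d₀ i) (dirAt 𝒯.U d₀ i + 3))) :
    dartEdge (f + cornerOff m) m ∉ 𝒯.hubE ∧ dartEdge (f + cornerOff m) m ∉ 𝒯.clE ∧ dartEdge (f + cornerOff m) m ∉ 𝒯.acc ∧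
      f + cornerOff m ∈ 𝒯.Wv ∧ f + cornerOff (m + 1) ∈ 𝒯.Wv := by
  rw [h.outCell] at hp
  obtain ⟨y, m', hym, hhub, hcl, hacc, hyW, hy'W⟩ := hp
  have he : dartEdge (f + cornerOff m) m = dartEdge y m' :=
    bcell_injOn (dartEdge_mem_edgeSet _ _) (dartEdge_mem_edgeSet _ _) (by rw [bcell_dartEdge, bcell_dartEdge, hym])
  rw [he]
  refine ⟨hhub, hcl, hacc, ?_, ?_⟩
  · have : f + cornerOff m ∈ dartEdge y m' := he ▸ mem_dartEdge_iff.2 (Or.inl rfl)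
    rcases mem_dartEdge_iff.1 this with h' | h' <;> rw [h'] <;> assumption
  · have : f + cornerOff (m + 1) ∈ dartEdge y m' := by
      rw [← he, add_cornerOff_succ]; exact mem_dartEdge_iff.2 (Or.inr rfl)
    rcases mem_dartEdge_iff.1 this with h' | h' <;> rw [h'] <;> assumption

/-- Along a pocket run the tracing turns left: if the `i`-th side is a pocket `f`-side and the next
out-cell is again a pocket cell, the next side is the next `f`-side. [folklore] -/
theorem FSide.succ_of_pocket {i : ℕ} {f : Site 2} {m : Fin 4} (h : FSide 𝒯.U d₀ i f m)
    (hp : 𝒯.IsPocketCell (faceAt (vert 𝒯.U d₀ i) (dirAt 𝒯.U d₀ i + 3)))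
    (hp' : 𝒯.IsPocketCell (faceAt (vert 𝒯.U d₀ (i + 1)) (dirAt 𝒯.U d₀ (i + 1) + 3))) :
    σc (f + cornerOff (m + 1)) ∉ 𝒯.U ∧ FSide 𝒯.U d₀ (i + 1) f (m + 1) := by
  obtain ⟨hhub, hcl, hacc, hW, hW'⟩ := pocket_edge h hp
  -- case R is excluded: the far corner site would be accessible and non-hub, and the pocket edge at it
  -- would be examined or accessible by the closure axiom
  have hσ : σc (f + cornerOff (m + 1)) ∉ 𝒯.U := by
    intro hσ
    obtain ⟨hO, e, he, hbe⟩ := (σc_mem_U_iff 𝒯).1 hσ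
    have hwin : ∀ u ∈ dartEdge (f + cornerOff m) m, u ∈ 𝒯.Wv := by
      intro u hu
      rcases mem_dartEdge_iff.1 hu with rfl | rfl
      · exact hW
      · rw [← add_cornerOff_succ]; exact hW'
    have hmem : f + cornerOff (m + 1) ∈ dartEdge (f + cornerOff m) m := by
      rw [add_cornerOff_succ]; exact mem_dartEdge_iff.2 (Or.inr rfl)
    rcases 𝒯.closure e he _ hbe hO _ (dartEdge_mem_edgeSet _ _) hmem hwin with h' | h' | h'
    · exact hhub h'
    · exact hcl h'
    · exact hacc h'
  refine ⟨hσ, ?_⟩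
  -- case S is excluded: the next out-cell would be a site cell
  by_cases hβ : βc (f + cornerOff (m + 1)) (m + 1) ∈ 𝒯.U
  · exact absurd (h.outCell_succ_of_bond_mem hσ hβ) (hp'.ne_σc _)
  · exact (h.succ_of_not_mem hσ hβ).1

/-- **The corner sites of a hub cell at the near corner of an `f`-side**: if a hub cell `c` lies at
the corner `vert i` of an `f`-side `i`, then `f + cornerOff m ∈ 𝒪` and the vertices attached to `c`
are hub-connected to it. [folklore] -/
theorem FSide.hubConn_near {i : ℕ} {f : Site 2} {m : Fin 4} (h : FSide 𝒯.U d₀ i f m) {c : Site 2}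
    (hc : 𝒯.IsHubCell c) (hcorner : ∃ t : Fin 4, c = faceAt (vert 𝒯.U d₀ i) t) {v : Site 2} (hv : v ∈ 𝒯.att c) :
    f + cornerOff m ∈ 𝒯.O ∧ 𝒯.HubConn v (f + cornerOff m) := by
  rw [h.vert_eq] at hcorner
  exact 𝒯.hubConn_att_corner hc hcorner hv

/-- The same at the far corner. [folklore] -/
theorem FSide.hubConn_far {i : ℕ} {f : Site 2} {m : Fin 4} (h : FSide 𝒯.U d₀ i f m) {c : Site 2}
    (hc : 𝒯.IsHubCell c) (hcorner : ∃ t : Fin 4, c = faceAt (vert 𝒯.U d₀ (i + 1)) t) {v : Site 2} (hv : v ∈ 𝒯.att c) :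
    f + cornerOff (m + 1) ∈ 𝒯.O ∧ 𝒯.HubConn v (f + cornerOff (m + 1)) := by
  rw [h.vert_succ] at hcorner
  exact 𝒯.hubConn_att_corner hc hcorner hv

/-! ### The pieces: chord and pocket lemmas along the sides of a face -/

section Pieces

variable (hT : 𝒯.Terminal)
  (hfar : ∀ c c' u₁ u₂ : Site 2, c ∈ 𝒯.O → c' ∈ 𝒯.O → (∃ f, TouchesFace c f ∧ TouchesFace c' f) →
    u₁ ∉ 𝒯.Wv → u₂ ∉ 𝒯.Wv → ReflTransGen (fun a b => s(a, b) ∈ 𝒯.hubE) c u₁ →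
    ReflTransGen (fun a b => s(a, b) ∈ 𝒯.hubE) c' u₂ → ReflTransGen (FarAdj 𝒯) u₂ u₁)
include hT hfar

omit hT hfar in
/-- The corners of a face touch it. [folklore] -/
theorem touchesFace_add_cornerOff (f : Site 2) (t : Fin 4) : TouchesFace (f + cornerOff t) f :=
  touchesFace_iff_exists_faceAt.2 ⟨t, (faceAt_add_cornerOff f t).symm⟩

/-- **Piece of length one** (the chord lemma along a side of a face of `U`). [folklore] -/
theorem hubConn_piece1 {f : Site 2} {k : Fin 4} (hfU : φc f ∈ 𝒯.U) (hb : f + cornerOff k ∈ 𝒯.O)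
    (hb' : f + cornerOff (k + 1) ∈ 𝒯.O) (hW : f + cornerOff k ∈ 𝒯.Wv) (hW' : f + cornerOff (k + 1) ∈ 𝒯.Wv)
    (hhub : dartEdge (f + cornerOff k) k ∉ 𝒯.hubE) (hcl : dartEdge (f + cornerOff k) k ∉ 𝒯.clE)
    (hacc : dartEdge (f + cornerOff k) k ∉ 𝒯.acc) : 𝒯.HubConn (f + cornerOff k) (f + cornerOff (k + 1)) := by
  rw [add_cornerOff_succ] at hb' hW' ⊢
  refine 𝒯.hubConn_of_chord hT hb hb' hW hW' hhub hcl hacc (Or.inl (by rw [faceAt_add_cornerOff]; exact hfU)) ?_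
  intro u₁ u₂ hu₁ hu₂ h₁ h₂
  refine hfar _ _ u₁ u₂ hb hb' ⟨f, touchesFace_add_cornerOff f k, ?_⟩ hu₁ hu₂ h₁ h₂
  rw [← add_cornerOff_succ]; exact touchesFace_add_cornerOff f (k + 1)

/-- **Piece of length two** (the pocket lemma along two sides of a face of `U`). [folklore] -/
theorem hubConn_piece2 {f : Site 2} {k : Fin 4} (hfU : φc f ∈ 𝒯.U) (hb : f + cornerOff k ∈ 𝒯.O)
    (hb₁ : f + cornerOff (k + 1) ∉ 𝒯.O) (hσ₁ : σc (f + cornerOff (k + 1)) ∉ 𝒯.U) (hb₂ : f + cornerOff (k + 2) ∈ 𝒯.O)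
    (hW : f + cornerOff k ∈ 𝒯.Wv) (hW₁ : f + cornerOff (k + 1) ∈ 𝒯.Wv) (hW₂ : f + cornerOff (k + 2) ∈ 𝒯.Wv)
    (hhub : dartEdge (f + cornerOff k) k ∉ 𝒯.hubE) (hcl : dartEdge (f + cornerOff k) k ∉ 𝒯.clE)
    (hacc : dartEdge (f + cornerOff k) k ∉ 𝒯.acc)
    (hhub' : dartEdge (f + cornerOff (k + 1)) (k + 1) ∉ 𝒯.hubE) (hcl' : dartEdge (f + cornerOff (k + 1)) (k + 1) ∉ 𝒯.clE)
    (hacc' : dartEdge (f + cornerOff (k + 1)) (k + 1) ∉ 𝒯.acc) :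
    𝒯.HubConn (f + cornerOff k) (f + cornerOff (k + 2)) := by
  have e1 : f + cornerOff (k + 1) = f + cornerOff k + cornerUnit k := add_cornerOff_succ f k
  have e2 : f + cornerOff (k + 2) = f + cornerOff k + cornerUnit k + cornerUnit (k + 1) := by
    rw [← e1, ← fin4_add_one_add_one, add_cornerOff_succ f (k + 1)]
  have hnacc : ∀ e ∈ 𝒯.acc, f + cornerOff (k + 1) ∉ e := by
    intro e he hmem
    exact hσ₁ ((σc_mem_U_iff 𝒯).2 ⟨hb₁, e, he, hmem⟩)
  have hne : f + cornerOff k ≠ f + cornerOff (k + 2) := by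
    intro h
    have := cornerOff_injective (add_left_cancel h)
    exact absurd this (by fin_cases k <;> decide)
  rw [e1] at hb₁ hW₁ hhub' hcl' hacc' hnacc
  rw [e2] at hb₂ hW₂ hne ⊢
  refine 𝒯.hubConn_of_pocket hT hb hb₁ hb₂ hne hW hW₁ hW₂ hnacc hhub hcl hacc hhub' hcl' hacc'
    (Or.inl (by rw [faceAt_add_cornerOff]; exact hfU)) ?_
  intro u₁ u₂ hu₁ hu₂ h₁ h₂
  refine hfar _ _ u₁ u₂ hb hb₂ ⟨f, touchesFace_add_cornerOff f k, ?_⟩ hu₁ hu₂ h₁ h₂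
  rw [← e2]; exact touchesFace_add_cornerOff f (k + 2)

end Pieces

/-! ### Pocket runs -/

section Run

variable (h₀ : IsBd 𝒯.U d₀) (hT : 𝒯.Terminal)
  (hfar : ∀ c c' u₁ u₂ : Site 2, c ∈ 𝒯.O → c' ∈ 𝒯.O → (∃ f, TouchesFace c f ∧ TouchesFace c' f) →
    u₁ ∉ 𝒯.Wv → u₂ ∉ 𝒯.Wv → ReflTransGen (fun a b => s(a, b) ∈ 𝒯.hubE) c u₁ →
    ReflTransGen (fun a b => s(a, b) ∈ 𝒯.hubE) c' u₂ → ReflTransGen (FarAdj 𝒯) u₂ u₁)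
include h₀

omit h₀ in
/-- A pocket cell is not a closed cell. [folklore] -/
theorem IsPocketCell.not_isClosedCell {c : Site 2} (h : 𝒯.IsPocketCell c) : ¬ 𝒯.IsClosedCell c := by
  obtain ⟨y, m, rfl, -, hcl, -⟩ := h
  rintro (⟨e, he, heE, hce⟩ | ⟨f, -, hcf⟩)
  · have : e = dartEdge y m := bcell_injOn heE (dartEdge_mem_edgeSet _ _) (by rw [← hce, bcell_dartEdge])
    exact hcl (this ▸ he)
  · exact βc_ne_φc y f m hcf

omit h₀ in
/-- A pocket cell is not an exterior cell. [folklore] -/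
theorem IsPocketCell.not_isExteriorCell {c : Site 2} (h : 𝒯.IsPocketCell c) : ¬ 𝒯.IsExteriorCell c := by
  obtain ⟨y, m, rfl, -, -, -, hyW, hy'W⟩ := h
  rintro ⟨y', m', hc, hW⟩
  have he : dartEdge y m = dartEdge y' m' :=
    bcell_injOn (dartEdge_mem_edgeSet _ _) (dartEdge_mem_edgeSet _ _) (by rw [bcell_dartEdge, bcell_dartEdge, hc])
  have h1 : y' ∈ dartEdge y m := he ▸ mem_dartEdge_iff.2 (Or.inl rfl)
  have h2 : y' + cornerUnit m' ∈ dartEdge y m := he ▸ mem_dartEdge_iff.2 (Or.inr rfl)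
  rcases hW with hW | hW
  · rcases mem_dartEdge_iff.1 h1 with h | h <;> rw [h] at hW
    · exact hW hyW
    · exact hW hy'W
  · rcases mem_dartEdge_iff.1 h2 with h | h <;> rw [h] at hW
    · exact hW hyW
    · exact hW hy'W

/-- **A pocket side is a face side.** [folklore] -/
theorem exists_fSide_of_pocket {i : ℕ} (hp : 𝒯.IsPocketCell (𝒯.outCell d₀ i)) :
    ∃ f m, FSide 𝒯.U d₀ i f m := by
  rcases out_classification (𝒯 := 𝒯) (isBd_bdOrbit h₀ i) with h | h | ⟨-, f, hf⟩ | h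
  · exact absurd h (not_isHubCell_of_isPocketCell hp)
  · exact absurd h hp.not_isClosedCell
  · obtain ⟨a, j, hfs, -⟩ := exists_faceSide_of_inCell hf
    exact ⟨_, _, fSide_of_faceSide hfs⟩
  · exact absurd h hp.not_isExteriorCell

include hT hfar

/-- **The pocket run lemma.**  If the sides `i+1, …, i+n` (`n ≥ 1`) of the loop have pocket
out-cells and the sides `i` and `i+n+1` are hub contacts, then the vertices attached to these two
hub cells are hub-connected. [cite: SchrammSmirnov2011, §4, proof of Prop. 4.1 ("the beach is connected")] -/
theorem hubConn_of_pocketRun {i n : ℕ} (hn : 1 ≤ n) (hpocket : ∀ t, t < n → 𝒯.IsPocketCell (𝒯.outCell d₀ (i + 1 + t)))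
    (hi : 𝒯.hubContact d₀ i) (hi' : 𝒯.hubContact d₀ (i + n + 1)) {v v' : Site 2}
    (hv : v ∈ 𝒯.att (𝒯.outCell d₀ i)) (hv' : v' ∈ 𝒯.att (𝒯.outCell d₀ (i + n + 1))) : 𝒯.HubConn v v' := by
  -- the face and the position of the first pocket side
  have hp0 : 𝒯.IsPocketCell (faceAt (vert 𝒯.U d₀ (i + 1)) (dirAt 𝒯.U d₀ (i + 1) + 3)) := by
    simpa [TileData.outCell] using hpocket 0 hn
  obtain ⟨f, m₀, hF0⟩ := exists_fSide_of_pocket h₀ hp0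
  -- the following sides of the run are the following sides of `f` (unrolled: the run is short)
  have hF1 : 1 < n → σc (f + cornerOff (m₀ + 1)) ∉ 𝒯.U ∧ FSide 𝒯.U d₀ (i + 1 + 1) f (m₀ + 1) := fun h1 =>
    FSide.succ_of_pocket hF0 hp0 (by simpa [TileData.outCell, add_assoc] using hpocket 1 h1)
  have hF2 : 2 < n → σc (f + cornerOff (m₀ + 1 + 1)) ∉ 𝒯.U ∧ FSide 𝒯.U d₀ (i + 1 + 1 + 1) f (m₀ + 1 + 1) := fun h2 =>
    FSide.succ_of_pocket (hF1 (by omega)).2 (by simpa [TileData.outCell, add_assoc] using hpocket 1 (by omega))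
      (by simpa [TileData.outCell, add_assoc] using hpocket 2 h2)
  have hF3 : 3 < n → σc (f + cornerOff (m₀ + 1 + 1 + 1)) ∉ 𝒯.U ∧ FSide 𝒯.U d₀ (i + 1 + 1 + 1 + 1) f (m₀ + 1 + 1 + 1) :=
    fun h3 => FSide.succ_of_pocket (hF2 (by omega)).2 (by simpa [TileData.outCell, add_assoc] using hpocket 2 (by omega))
      (by simpa [TileData.outCell, add_assoc] using hpocket 3 h3)
  -- the edges of the run are fresh window edges
  have hE0 := pocket_edge hF0 hp0
  have hE1 : 1 < n → _ := fun h1 => pocket_edge (hF1 h1).2 (by simpa [TileData.outCell, add_assoc] using hpocket 1 h1)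
  have hE2 : 2 < n → _ := fun h2 => pocket_edge (hF2 h2).2 (by simpa [TileData.outCell, add_assoc] using hpocket 2 h2)
  have hE3 : 3 < n → _ := fun h3 => pocket_edge (hF3 h3).2 (by simpa [TileData.outCell, add_assoc] using hpocket 3 h3)
  -- the face is in `U`
  have hfU : φc f ∈ 𝒯.U := by
    have := (isBd_bdOrbit h₀ (i + 1)).1
    rwa [show (bdOrbit 𝒯.U d₀ (i + 1)).1 = vert 𝒯.U d₀ (i + 1) from rfl,
      show (bdOrbit 𝒯.U d₀ (i + 1)).2 = dirAt 𝒯.U d₀ (i + 1) from rfl, hF0.inCell] at this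
  obtain ⟨-, eacc, heacc, hfe⟩ := (φc_mem_U_iff 𝒯).1 hfU
  obtain ⟨m', rfl⟩ := (isFaceOf_iff_exists_faceSide (𝒯.acc_edge eacc heacc)).1 hfe
  obtain ⟨t, rfl⟩ := fin4_exists_add m₀ m'
  -- the run has length at most three: otherwise all four sides of `f` would be inaccessible
  have hn3 : n ≤ 3 := by
    by_contra hn4
    rcases (show t = 0 ∨ t = 1 ∨ t = 2 ∨ t = 3 by fin_cases t <;> simp) with rfl | rfl | rfl | rfl
    · exact hE0.2.2.1 (by simpa [faceSide] using heacc)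
    · exact (hE1 (by omega)).2.2.1 heacc
    · rw [← fin4_add_one_add_one] at heacc; exact (hE2 (by omega)).2.2.1 heacc
    · rw [← fin4_one_one_one] at heacc; exact (hE3 (by omega)).2.2.1 heacc
  -- the pieces
  have P1 : ∀ k : Fin 4, f + cornerOff k ∈ 𝒯.O → f + cornerOff (k + 1) ∈ 𝒯.O →
      (dartEdge (f + cornerOff k) k ∉ 𝒯.hubE ∧ dartEdge (f + cornerOff k) k ∉ 𝒯.clE ∧ dartEdge (f + cornerOff k) k ∉ 𝒯.acc ∧
        f + cornerOff k ∈ 𝒯.Wv ∧ f + cornerOff (k + 1) ∈ 𝒯.Wv) → 𝒯.HubConn (f + cornerOff k) (f + cornerOff (k + 1)) :=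
    fun k hb hb' ⟨hhub, hcl, hacc, hW, hW'⟩ => hubConn_piece1 hT hfar hfU hb hb' hW hW' hhub hcl hacc
  have P2 : ∀ k : Fin 4, f + cornerOff k ∈ 𝒯.O → f + cornerOff (k + 1) ∉ 𝒯.O → σc (f + cornerOff (k + 1)) ∉ 𝒯.U →
      f + cornerOff (k + 1 + 1) ∈ 𝒯.O →
      (dartEdge (f + cornerOff k) k ∉ 𝒯.hubE ∧ dartEdge (f + cornerOff k) k ∉ 𝒯.clE ∧ dartEdge (f + cornerOff k) k ∉ 𝒯.acc ∧
        f + cornerOff k ∈ 𝒯.Wv ∧ f + cornerOff (k + 1) ∈ 𝒯.Wv) →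
      (dartEdge (f + cornerOff (k + 1)) (k + 1) ∉ 𝒯.hubE ∧ dartEdge (f + cornerOff (k + 1)) (k + 1) ∉ 𝒯.clE ∧
        dartEdge (f + cornerOff (k + 1)) (k + 1) ∉ 𝒯.acc ∧ f + cornerOff (k + 1) ∈ 𝒯.Wv ∧ f + cornerOff (k + 1 + 1) ∈ 𝒯.Wv) →
      𝒯.HubConn (f + cornerOff k) (f + cornerOff (k + 1 + 1)) := by
    rintro k hb hb₁ hσ₁ hb₂ ⟨hhub, hcl, hacc, hW, hW'⟩ ⟨hhub', hcl', hacc', -, hW''⟩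
    rw [fin4_add_one_add_one] at hb₂ hW'' ⊢
    exact hubConn_piece2 hT hfar hfU hb hb₁ hσ₁ hb₂ hW hW' hW'' hhub hcl hacc hhub' hcl' hacc'
  -- entry corner
  obtain ⟨hb₀, hventry⟩ : f + cornerOff m₀ ∈ 𝒯.O ∧ 𝒯.HubConn v (f + cornerOff m₀) :=
    FSide.hubConn_near hF0 hi (𝒯.outCell_corner d₀ i).1 hv
  refine hventry.trans ?_
  -- case analysis on `n ∈ {1, 2, 3}`
  rcases (by omega : n = 1 ∨ n = 2 ∨ n = 3) with rfl | rfl | rfl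
  · -- one pocket side: exit at `f + cornerOff (m₀ + 1)`
    obtain ⟨hb₁, hvexit⟩ := FSide.hubConn_far hF0 hi' ⟨_, rfl⟩ hv'
    exact (P1 m₀ hb₀ hb₁ hE0).trans hvexit.symm
  · obtain ⟨hb₂, hvexit⟩ := FSide.hubConn_far (hF1 (by omega)).2 hi' ⟨_, rfl⟩ hv'
    refine HubConn.trans ?_ hvexit.symm
    by_cases hb₁ : f + cornerOff (m₀ + 1) ∈ 𝒯.O
    · exact (P1 m₀ hb₀ hb₁ hE0).trans (P1 (m₀ + 1) hb₁ hb₂ (hE1 (by omega)))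
    · exact P2 m₀ hb₀ hb₁ (hF1 (by omega)).1 hb₂ hE0 (hE1 (by omega))
  · obtain ⟨hb₃, hvexit⟩ := FSide.hubConn_far (hF2 (by omega)).2 hi' ⟨_, rfl⟩ hv'
    refine HubConn.trans ?_ hvexit.symm
    by_cases hb₁ : f + cornerOff (m₀ + 1) ∈ 𝒯.O <;> by_cases hb₂ : f + cornerOff (m₀ + 1 + 1) ∈ 𝒯.O
    · -- O, O: three chords
      exact ((P1 m₀ hb₀ hb₁ hE0).trans (P1 (m₀ + 1) hb₁ hb₂ (hE1 (by omega)))).trans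
        (P1 (m₀ + 1 + 1) hb₂ hb₃ (hE2 (by omega)))
    · -- O, ¬O: chord then pocket
      exact (P1 m₀ hb₀ hb₁ hE0).trans (P2 (m₀ + 1) hb₁ hb₂ (hF2 (by omega)).1 hb₃ (hE1 (by omega)) (hE2 (by omega)))
    · -- ¬O, O: pocket then chord
      exact (P2 m₀ hb₀ hb₁ (hF1 (by omega)).1 hb₂ hE0 (hE1 (by omega))).trans (P1 (m₀ + 1 + 1) hb₂ hb₃ (hE2 (by omega)))
    · -- ¬O, ¬O: the accessible side of `f` would join two hub vertices
      exfalso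
      rcases (show t = 0 ∨ t = 1 ∨ t = 2 ∨ t = 3 by fin_cases t <;> simp) with rfl | rfl | rfl | rfl
      · exact hE0.2.2.1 (by simpa [faceSide] using heacc)
      · exact (hE1 (by omega)).2.2.1 heacc
      · rw [← fin4_add_one_add_one] at heacc; exact (hE2 (by omega)).2.2.1 heacc
      · -- the fourth side: endpoints `f + cornerOff (m₀+3)` and `f + cornerOff m₀`, both hub vertices
        obtain ⟨w, hw, hwO⟩ := 𝒯.acc_nonO _ heacc
        rw [faceSide] at hw
        rcases mem_dartEdge_iff.1 hw with rfl | rfl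
        · rw [← fin4_one_one_one] at hwO; exact hwO hb₃
        · rw [← add_cornerOff_succ, fin4_add_three_add_one] at hwO
          exact hwO hb₀

omit hT hfar in
/-- On an open stretch a side is a hub contact or has a pocket out-cell. [folklore] -/
theorem hubContact_or_pocket {l : ℕ} (hcl : ¬ 𝒯.IsClosedCell (𝒯.outCell d₀ l))
    (hext : ¬ 𝒯.IsExteriorCell (𝒯.outCell d₀ l)) : 𝒯.hubContact d₀ l ∨ 𝒯.IsPocketCell (𝒯.outCell d₀ l) := by
  rcases out_classification (𝒯 := 𝒯) (isBd_bdOrbit h₀ l) with h | h | ⟨h, -⟩ | h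
  · exact Or.inl h
  · exact absurd h hcl
  · exact Or.inr h
  · exact absurd h hext

/-- **The port theorem.**  On a stretch `i ≤ l ≤ i'` of the traced loop of the tile domain with no
closed and no exterior contact, the vertices attached to any two hub contacts are joined by examined
open edges: a port has ONE owner hub. [cite: SchrammSmirnov2011, §4, proof of Prop. 4.1 ("It is easy to see that the beach is connected")] -/
theorem hubConn_of_open_stretch {i i' : ℕ} (hii' : i ≤ i')
    (hopen : ∀ l, i ≤ l → l ≤ i' → ¬ 𝒯.IsClosedCell (𝒯.outCell d₀ l) ∧ ¬ 𝒯.IsExteriorCell (𝒯.outCell d₀ l))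
    (hi : 𝒯.hubContact d₀ i) (hi' : 𝒯.hubContact d₀ i') {v v' : Site 2}
    (hv : v ∈ 𝒯.att (𝒯.outCell d₀ i)) (hv' : v' ∈ 𝒯.att (𝒯.outCell d₀ i')) : 𝒯.HubConn v v' := by
  -- strong induction on the length of the stretch
  induction hd : i' - i using Nat.strong_induction_on generalizing i v with
  | _ d ih =>
    rcases hii'.eq_or_lt with rfl | hlt
    · exact 𝒯.hubConn_of_run le_rfl (fun l h1 h2 => by rw [le_antisymm h2 h1]; exact hi) hv hv'
    · rcases hubContact_or_pocket h₀ (hopen (i + 1) (by omega) (by omega)).1 (hopen (i + 1) (by omega) (by omega)).2 with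
        hhub | hpk
      · -- the next side is a hub contact
        obtain ⟨w, hw⟩ := 𝒯.att_nonempty hhub
        refine (𝒯.hubConn_of_consecutive hi hhub hv hw).trans ?_
        exact ih (i' - (i + 1)) (by omega) (by omega) (fun l h1 h2 => hopen l (by omega) h2) hhub hw rfl
      · -- a pocket run up to the first hub contact `q` after `i`
        classical
        have hex : ∃ q, i < q ∧ 𝒯.hubContact d₀ q := ⟨i', hlt, hi'⟩
        set q := Nat.find hex with hq
        obtain ⟨hiq, hqhub⟩ : i < q ∧ 𝒯.hubContact d₀ q := Nat.find_spec hex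
        have hqi' : q ≤ i' := Nat.find_min' hex ⟨hlt, hi'⟩
        have hmin : ∀ l, i < l → l < q → ¬ 𝒯.hubContact d₀ l := fun l h1 h2 h3 =>
          Nat.find_min hex (by rwa [← hq]) ⟨h1, h3⟩
        have hq2 : i + 2 ≤ q := by
          by_contra h
          have : q = i + 1 := by omega
          exact not_isHubCell_of_isPocketCell hpk (this ▸ hqhub)
        set n := q - i - 1 with hn
        have hpocket : ∀ t, t < n → 𝒯.IsPocketCell (𝒯.outCell d₀ (i + 1 + t)) := by
          intro t ht
          have h1 := hopen (i + 1 + t) (by omega) (by omega)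
          rcases hubContact_or_pocket h₀ h1.1 h1.2 with h | h
          · exact absurd h (hmin _ (by omega) (by omega))
          · exact h
        obtain ⟨w, hw⟩ := 𝒯.att_nonempty hqhub
        have hqeq : i + n + 1 = q := by omega
        have hrun := hubConn_of_pocketRun h₀ hT hfar (i := i) (n := n) (by omega) hpocket hi (hqeq ▸ hqhub) hv
          (v' := w) (by rw [hqeq]; exact hw)
        refine hrun.trans ?_
        exact ih (i' - q) (by omega) hqi' (fun l h1 h2 => hopen l (by omega) h2) hqhub hw rfl

/-- **The port theorem, hub-or-pocket form.**  The same conclusion when every side of the stretch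
is known to be a hub contact or to have a pocket out-cell (the form used for counting: a hub cell of
an edge leaving the window is also an exterior cell). [cite: SchrammSmirnov2011, §4, proof of Prop. 4.1] -/
theorem hubConn_of_open_stretch' {i i' : ℕ} (hii' : i ≤ i')
    (hopen : ∀ l, i ≤ l → l ≤ i' → 𝒯.hubContact d₀ l ∨ 𝒯.IsPocketCell (𝒯.outCell d₀ l))
    (hi : 𝒯.hubContact d₀ i) (hi' : 𝒯.hubContact d₀ i') {v v' : Site 2}
    (hv : v ∈ 𝒯.att (𝒯.outCell d₀ i)) (hv' : v' ∈ 𝒯.att (𝒯.outCell d₀ i')) : 𝒯.HubConn v v' := by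
  -- strong induction on the length of the stretch
  induction hd : i' - i using Nat.strong_induction_on generalizing i v with
  | _ d ih =>
    rcases hii'.eq_or_lt with rfl | hlt
    · exact 𝒯.hubConn_of_run le_rfl (fun l h1 h2 => by rw [le_antisymm h2 h1]; exact hi) hv hv'
    · rcases hopen (i + 1) (by omega) (by omega) with hhub | hpk
      · obtain ⟨w, hw⟩ := 𝒯.att_nonempty hhub
        refine (𝒯.hubConn_of_consecutive hi hhub hv hw).trans ?_
        exact ih (i' - (i + 1)) (by omega) (by omega) (fun l h1 h2 => hopen l (by omega) h2) hhub hw rfl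
      · classical
        have hex : ∃ q, i < q ∧ 𝒯.hubContact d₀ q := ⟨i', hlt, hi'⟩
        set q := Nat.find hex with hq
        obtain ⟨hiq, hqhub⟩ : i < q ∧ 𝒯.hubContact d₀ q := Nat.find_spec hex
        have hqi' : q ≤ i' := Nat.find_min' hex ⟨hlt, hi'⟩
        have hmin : ∀ l, i < l → l < q → ¬ 𝒯.hubContact d₀ l := fun l h1 h2 h3 =>
          Nat.find_min hex (by rwa [← hq]) ⟨h1, h3⟩
        have hq2 : i + 2 ≤ q := by
          by_contra h
          have : q = i + 1 := by omega
          exact not_isHubCell_of_isPocketCell hpk (this ▸ hqhub)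
        set n := q - i - 1 with hn
        have hpocket : ∀ t, t < n → 𝒯.IsPocketCell (𝒯.outCell d₀ (i + 1 + t)) := by
          intro t ht
          rcases hopen (i + 1 + t) (by omega) (by omega) with h | h
          · exact absurd h (hmin _ (by omega) (by omega))
          · exact h
        obtain ⟨w, hw⟩ := 𝒯.att_nonempty hqhub
        have hqeq : i + n + 1 = q := by omega
        have hrun := hubConn_of_pocketRun h₀ hT hfar (i := i) (n := n) (by omega) hpocket hi (hqeq ▸ hqhub) hv
          (v' := w) (by rw [hqeq]; exact hw)
        refine hrun.trans ?_
        exact ih (i' - q) (by omega) hqi' (fun l h1 h2 => hopen l (by omega) h2) hqhub hw rfl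

end Run

end TileData

end CellComplex

end Literature.Probability.Percolation

end
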